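import Summits.QuantumFields.BalabanUV.Beta.FP.KPerfSymHolds
import Summits.QuantumFields.BalabanUV.Beta.HessKerCoDressedWall
import Summits.QuantumFields.BalabanUV.Beta.CombChartStepJets

/-!
# `BalabanUV.Beta.GAN24.KSlotCombChart` — binder row G-an2-4 ∕ (CONV-C), THE K-SLOT AT ROW D1's LITERAL OF RECORD (III′): the wall's resolvent rows
# `(hK, hKall)` for the COMB-CHART step resolvents `G′_j = GcombSh Lc j = coDressKAt ρ_c Lc (coDressKSymAt ρ_c Lc (KInvStep Lc j))` in the adopted leg
# units `(sfStep Lc j, smStep 3 Lc j)`, UNCONDITIONAL for `d = 3`, every `Lc ≥ 2` — gan24's `KSlotAssembly.convCKWall_holds` pushed through BOTH co-dressings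
# BY NAME (road FP's `KPerfSymHolds.kSlotSym_ctr_holds` for the symmetrised block-mean pass, asym1's `HessKerCoDressedWall.exists_coDressed_unit_rows` for
# the axial pass), plus the constructed-limit readings of asym1's `HessKerDressedLimit`
# (G-an2-4 crux team (2), leaf prover 02 `b2b-balaban-gan24-formalise-leaf-02` gen 77; the (III′) twin of the (E) chain's K-slot letter, located as
# «S-sized» in the OWNER gan24-p1 g45's sizing memo `TRANSFER-III-SIZING.v0_3.md` §3(b) ∕ §4.2, journal [GAN24P1-G45-MEMO-1])

HONEST DEPENDENCY (page 1, mandatory): continuum YM on T⁴ ⇐ BetaPertH ∧ nine spine estimates (0/9 proved); BetaPertH ⇐ (D1) ∧ (D4) ∧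
CAP+tail; G-an2-4 gates asym, D1 and NE2/3/4.  HONEST FRAMING (cell contract, verbatim): «discharging `BetaPertH` makes Bałaban's UV
stability UNCONDITIONAL — a real constructive-QFT result; it is NOT the continuum limit and NOT the Clay problem.»
ABSOLUTE RULE (cell charter, verbatim): «No internally-minted statement may enter as a cited fact. Every hypothesis is either kernel-proved in
this package or a verbatim quotation of a PUBLISHED theorem with page reference. The manuscript(s) under audit are NOT citable for their own
disputed steps — they are the thing under adjudication; programme-internal (2001/route/tribunal) claims are never citable.»
NOTHING below is cited; no `def`, no `def … : Prop`, 0 sorry.  NOT IN PRINT; OUR BOOKKEEPING ([folklore] composition BY NAME of tree theorems).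

WHY.  Row D1's literal of record is the COMB chart (III′) `CombChartJointEnd.JsB12CombShSym hLc N tabs cΛ cB` (an2 W-4, journal l.64553), whose Hessian
kernel's resolvent at step `j` is `GcombSh Lc j` (`CombChartJointEnd.TbalOf_JsB12CombShSym`).  Any (α-0)-type END for that literal — the analogue of
road-P2's `WrecAtEvenHalfRowsOfTowerEnd.exists_allScalesSeq_JsRowD1Pin` at (E) — consumes, slot by slot, the wall's three binder pairs; the FIRST is the
resolvent pair `(hK, hKall)`: `j`-UNIFORM decay and GEOMETRIC all-scales deviations of the unit-rescaled resolvents `unitK (sfStep Lc j) (smStep 3 Lc j) G′_j`.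
At (E) that pair was gan24's `KSlotAssembly.convCKWall_holds` (for `KInvStep`) pushed through the block-mean co-dressing (road FP's `RoadRebasedHoldsBm`).
At (III′) the resolvent carries TWO co-dressings — the symmetrised block-mean one (`Gsym Lc j = coDressKSymAt ρ_c Lc (KInvStep Lc j)`, `SymmetrisedStepJets`)
and the axial one (`GcombSh Lc j = coDressKAt ρ_c Lc (Gsym Lc j)`, `CombChartStepJets`) — and BOTH transports are tree theorems: road FP's
`KPerfSymHolds.kSlotSym_ctr_holds` (the rows of `j ↦ unitK_j (Gsym Lc j)`, unconditional, `d = 3`, `2 ≤ Lc`) and asym1's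
`HessKerCoDressedWall.exists_coDressed_unit_rows` (rows pass through `coDressKAt` at any in-block root, any nonzero units).  This file composes them.

CONTENT (`d + 1 = 4`; `Lc ≥ 2`; centred root `ρ_c = ctr 4 Lc = toSite (ctrOff 4 Lc)`; units `sfStep Lc j = Lc^j`, `smStep 3 Lc j = Lc^{4j}`).
* §1 **`kSlotCombSh_holds`** — `∃ C δ cK θ, 0 < δ ∧ 0 ≤ θ ∧ θ < 1 ∧ (∀ j, Decays (unitK_j (GcombSh Lc j)) C δ) ∧ ∀ k j, Decays (unitK_{k+j} (GcombSh Lc (k+j)) −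
  unitK_k (GcombSh Lc k)) (cK·θ^k) δ`: the wall's `(hK, hKall)` for the comb-chart resolvents; **`uniformDecays_decayCauchy_unitK_GcombSh`** — the same pair in
  `GAN24.CombesThomas` vocabulary (`UniformDecays ∧ DecayCauchy`, the shape of `ConvCKWall` for this family).
* §2 the constructed `η → 0` limit `G′_∞ := limMKerOf (j ↦ unitK_j (GcombSh Lc j))` (asym1's `HessKerDressedLimit`): **`decays_lim_unitK_GcombSh`**
  (`G′_∞` decays, same constant), **`decays_unitK_GcombSh_sub_lim`** (geometric `Decays`-rate to it, same constant), **`tendsto_unitK_GcombSh`**.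
* §3 (any `d`, root `ρ`, blocking `N`; NO letter on the family) **`tendsto_coDressKAt`** ∕ **`limMKerOf_coDressKAt`** — ENTRYWISE LIMITS PASS THROUGH THE AXIAL
  CO-DRESSING `coDressKAt ρ N = piKᵀ ∘ · ∘ piK` (finite window sums, an2's `AxialDressingRootedKernel` letters `sum_piK_col_inl ∕ trK_piK_comp_inr ∕ comp_piK_inr ∕
  tsum_window'`); the twin of road FP's `KPerfSymHolds.tendsto_coDressKSymAt` for the symmetrised block-mean co-dressing.
* §4 (`d = 3`, `Lc ≥ 2`) **`limMKerOf_unitK_GcombSh`**: `G′_∞ = coDressKAt ρ_c Lc (coDressKSymAt ρ_c Lc (KPerf Lc (sfStep Lc) (smStep 3 Lc) 1))` — the comb-chart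
  resolvents' perfect limit IS the two co-dressings of road FP's perfect one-step resolvent (`KPerfSymHolds.tendsto_unitK_Gsym` through §3, units inside by asym1's
  `unitK_coDressKAt`); **`tendsto_unitK_GcombSh_perf`**, **`decays_unitK_GcombSh_sub_perf`** (geometric `Decays`-rate to the IDENTIFIED limit), **`decays_GcombPerf`**.
WHAT IT IS NOT.  It supplies NO S-slot or W-slot row at (III′), NO parity letter, NO value; it is the K-side bookkeeping only.  (CONV-C)'s K-slot CONTENT is
gan24's `FibreRate.realRateK` (inside `convCKWall_holds`); nothing new is estimated here.  The (III′) END itself is NOT asked (an2 W-4; OWNER memo §4.1).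
NEVER «G-an2-4 closed» as (CONV-C); NOT D1, NOT `BetaPertH`, NOT continuum, NOT Clay.  2026-08-25.
-/

noncomputable section

open Filter Topology
open scoped BigOperators
open Literature.MathematicalPhysics.QuantumFieldTheory
open Literature.MathematicalPhysics.QuantumFieldTheory.Balaban1983to89
open Literature.MathematicalPhysics.QuantumFieldTheory.Balaban1983to89.Beta
open ExpKernelCalculus (MKer Decays comp)
open AffineAveraging (box toSite)
open AveragingContoursRooted (ctr ctrOff ctrOff_mem_box)
open OneStepResolventKernel (Fib)
open HessKerDressedLimit (limMKerOf limMKerOf_eq_of_tendsto decays_limMKerOf decays_sub_limMKerOf tendsto_limMKerOf_of_decays)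
open Summit.QuantumFields.BalabanUV.Beta.HessKerDressedUnits (unitK)
open Summit.QuantumFields.BalabanUV.Beta.TameKernelCalculus (trK trK_apply)
open Summit.QuantumFields.BalabanUV.Beta.AxialDressingRooted (one_le_of_neZero cube pm piK coDressKAt coDressKAt_eq sum_piK_col_inl trK_piK_comp_inr
  comp_piK_inr tsum_window')
open Summit.QuantumFields.BalabanUV.Beta.SymmetrisedDressingKernel (coDressKSymAt)
open Summit.QuantumFields.BalabanUV.Beta.SymmetrisedStepJets (Gsym)
open Summit.QuantumFields.BalabanUV.Beta.CombChartStepJets (GcombSh GcombSh_apply)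
open Summit.QuantumFields.BalabanUV.Beta.GAN24.CombesThomas (sfStep smStep sfStep_ne_zero smStep_ne_zero UniformDecays DecayCauchy)
open Summit.QuantumFields.BalabanUV.Beta.FP.PerfectObjectsT (KPerf)
open Summit.QuantumFields.BalabanUV.Beta.FP.KPerfSymHolds (kSlotSym_ctr_holds tendsto_unitK_Gsym exists_decays_coDressKSymAt_KPerf_one)
open Summit.QuantumFields.BalabanUV.Beta.HessKerCoDressedWall (exists_coDressed_unit_rows unitK_coDressKAt exists_decays_coDressKAt)

namespace Summit.QuantumFields.BalabanUV.Beta.GAN24.KSlotCombChart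

variable {Lc : ℕ} [NeZero Lc]

/-! ## §1 The wall's resolvent rows `(hK, hKall)` for the comb-chart step resolvents, unconditional (`d = 3`, `Lc ≥ 2`) -/

/-- [our object; folklore composition] **THE K-SLOT AT (III′), UNCONDITIONAL.**  For `d = 3` and every `Lc ≥ 2` there are `C, δ > 0, cK, 0 ≤ θ < 1` with
`Decays (unitK (sfStep Lc j) (smStep 3 Lc j) (GcombSh Lc j)) C δ` for every `j` and
`Decays (unitK_{k+j} (GcombSh Lc (k+j)) − unitK_k (GcombSh Lc k)) (cK·θ^k) δ` for all `k, j` — road FP's `KPerfSymHolds.kSlotSym_ctr_holds` (the rows of the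
symmetrised co-dressed family `Gsym`, from gan24's `KSlotAssembly.convCKWall_holds`) pushed through the axial co-dressing at the centred root by asym1's
`HessKerCoDressedWall.exists_coDressed_unit_rows` (`GcombSh Lc j = coDressKAt (ctr 4 Lc) Lc (Gsym Lc j)`, `ctr 4 Lc = toSite (ctrOff 4 Lc)` by `rfl`). -/
theorem kSlotCombSh_holds (hLc : 2 ≤ Lc) :
    ∃ C δ cK θ : ℝ, 0 < δ ∧ 0 ≤ θ ∧ θ < 1 ∧
      (∀ j, Decays (unitK (sfStep Lc j) (smStep 3 Lc j) (GcombSh (d := 3) Lc j)) C δ) ∧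
      ∀ k j, Decays (unitK (sfStep Lc (k + j)) (smStep 3 Lc (k + j)) (GcombSh (d := 3) Lc (k + j)) -
        unitK (sfStep Lc k) (smStep 3 Lc k) (GcombSh (d := 3) Lc k)) (cK * θ ^ k) δ := by
  obtain ⟨C, δ, cK, θ, hδ, hθ0, hθ1, hG, hGall⟩ := kSlotSym_ctr_holds hLc
  obtain ⟨c, -, h1, h2⟩ := exists_coDressed_unit_rows (d := 3) (one_le_of_neZero Lc) (ctrOff_mem_box (one_le_of_neZero Lc))
    (sfStep Lc) (smStep 3 Lc) sfStep_ne_zero smStep_ne_zero (K := fun j => Gsym (d := 3) Lc j) hδ hG hGall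
  refine ⟨c * C, δ / 4, c * cK, θ, by linarith, hθ0, hθ1, fun j => ?_, fun k j => ?_⟩
  · rw [GcombSh_apply]
    exact h1 j
  · rw [GcombSh_apply, GcombSh_apply]
    exact h2 k j

/-- [folklore] **THE SAME PAIR IN `CombesThomas` VOCABULARY**: `UniformDecays (j ↦ unitK_j (GcombSh Lc j)) C δ ∧ DecayCauchy (j ↦ unitK_j (GcombSh Lc j)) cK θ δ`
with `0 < δ`, `0 ≤ θ < 1` — the shape of `CombesThomas.ConvCKWall` (there stated for `KInvStep`) for the comb-chart resolvents. -/
theorem uniformDecays_decayCauchy_unitK_GcombSh (hLc : 2 ≤ Lc) :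
    ∃ C δ cK θ : ℝ, 0 < δ ∧ 0 ≤ θ ∧ θ < 1 ∧
      UniformDecays (fun j => unitK (sfStep Lc j) (smStep 3 Lc j) (GcombSh (d := 3) Lc j)) C δ ∧
      DecayCauchy (fun j => unitK (sfStep Lc j) (smStep 3 Lc j) (GcombSh (d := 3) Lc j)) cK θ δ :=
  kSlotCombSh_holds hLc

/-! ## §2 The constructed `η → 0` limit of the unit-rescaled comb-chart resolvents (a NAME; asym1's closure lemmas) -/

/-- [folklore] **THE CONSTRUCTED LIMIT DECAYS** (same constant and rate as the rows): `Decays (limMKerOf (j ↦ unitK_j (GcombSh Lc j))) C δ`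
(`HessKerDressedLimit.decays_limMKerOf`). -/
theorem decays_lim_unitK_GcombSh (hLc : 2 ≤ Lc) :
    ∃ C δ : ℝ, 0 < δ ∧ Decays (limMKerOf fun j => unitK (sfStep Lc j) (smStep 3 Lc j) (GcombSh (d := 3) Lc j)) C δ := by
  obtain ⟨C, δ, cK, θ, hδ, -, hθ1, hG, hGall⟩ := kSlotCombSh_holds hLc
  exact ⟨C, δ, hδ, decays_limMKerOf hG hGall hθ1⟩

/-- [folklore] **GEOMETRIC `Decays`-RATE TO THE CONSTRUCTED LIMIT, SAME CONSTANT**: `Decays (unitK_k (GcombSh Lc k) − limMKerOf (…)) (cK·θ^k) δ` for every `k`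
(`HessKerDressedLimit.decays_sub_limMKerOf`). -/
theorem decays_unitK_GcombSh_sub_lim (hLc : 2 ≤ Lc) :
    ∃ δ cK θ : ℝ, 0 < δ ∧ 0 ≤ θ ∧ θ < 1 ∧
      ∀ k, Decays (unitK (sfStep Lc k) (smStep 3 Lc k) (GcombSh (d := 3) Lc k) -
        limMKerOf (fun j => unitK (sfStep Lc j) (smStep 3 Lc j) (GcombSh (d := 3) Lc j))) (cK * θ ^ k) δ := by
  obtain ⟨C, δ, cK, θ, hδ, hθ0, hθ1, -, hGall⟩ := kSlotCombSh_holds hLc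
  exact ⟨δ, cK, θ, hδ, hθ0, hθ1, fun k =>
    decays_sub_limMKerOf (K := fun j => unitK (sfStep Lc j) (smStep 3 Lc j) (GcombSh (d := 3) Lc j)) hGall hθ1 k⟩

/-- [folklore] **ENTRYWISE CONVERGENCE OF THE UNIT-RESCALED COMB-CHART RESOLVENTS** to the constructed limit (`HessKerDressedLimit.tendsto_limMKerOf_of_decays`). -/
theorem tendsto_unitK_GcombSh (hLc : 2 ≤ Lc) (x y : Fin (3 + 1) → ℤ) (a b : Fib 3) :
    Tendsto (fun j => unitK (sfStep Lc j) (smStep 3 Lc j) (GcombSh (d := 3) Lc j) x y a b) atTop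
      (𝓝 (limMKerOf (fun j => unitK (sfStep Lc j) (smStep 3 Lc j) (GcombSh (d := 3) Lc j)) x y a b)) := by
  obtain ⟨C, δ, cK, θ, -, -, hθ1, -, hGall⟩ := kSlotCombSh_holds hLc
  exact tendsto_limMKerOf_of_decays hGall hθ1 x y a b

/-! ## §3 Entrywise limits pass through the AXIAL co-dressing (any `d`, root, blocking; letter-free) -/

section Window

variable {d : ℕ} (ρ : Fin (d + 1) → ℤ) (N : ℕ)

/-- [folklore] LEFT FACTOR, FIELD ROW: `(piKᵀ ∘ K) x y (inl α) b = Σ_{v ∈ cube} Σ_κ pm ρ N α x κ (x − v) · K (x − v) y (inl κ) b` — a FINITE window sum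
(an2's `sum_piK_col_inl` + `tsum_window'`; the multiplier row is an2's `trK_piK_comp_inr`). -/
theorem comp_trK_piK_inl (K : MKer (d + 1) (Fib d)) (x y : Fin (d + 1) → ℤ) (α : Fin (d + 1)) (b : Fib d) :
    comp (trK (piK ρ N)) K x y (Sum.inl α) b =
      ∑ v ∈ cube (d + 1) N, ∑ κ : Fin (d + 1), (pm ρ N α x κ (x - v) : ℝ) * K (x - v) y (Sum.inl κ) b := by
  unfold ExpKernelCalculus.comp
  have h : ∀ z, ∑ f : Fib d, trK (piK ρ N) x z (Sum.inl α) f * K z y f b =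
      if x - z ∈ cube (d + 1) N then ∑ κ : Fin (d + 1), (pm ρ N α x κ z : ℝ) * K z y (Sum.inl κ) b else 0 := by
    intro z
    simp only [trK_apply]
    exact sum_piK_col_inl ρ N z x α (fun f => K z y f b)
  simp_rw [h]
  exact tsum_window' N x fun z => ∑ κ : Fin (d + 1), (pm ρ N α x κ z : ℝ) * K z y (Sum.inl κ) b

/-- [folklore] RIGHT FACTOR, FIELD COLUMN: `(A ∘ piK) x y a (inl β) = Σ_{v ∈ cube} Σ_κ pm ρ N β y κ (y − v) · A x (y − v) a (inl κ)` — a FINITE window sum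
(an2's `sum_piK_col_inl` + `tsum_window'`; the multiplier column is an2's `comp_piK_inr`). -/
theorem comp_piK_inl (A : MKer (d + 1) (Fib d)) (x y : Fin (d + 1) → ℤ) (a : Fib d) (β : Fin (d + 1)) :
    comp A (piK ρ N) x y a (Sum.inl β) =
      ∑ v ∈ cube (d + 1) N, ∑ κ : Fin (d + 1), (pm ρ N β y κ (y - v) : ℝ) * A x (y - v) a (Sum.inl κ) := by
  unfold ExpKernelCalculus.comp
  have h : ∀ z, ∑ f : Fib d, A x z a f * piK ρ N z y f (Sum.inl β) =
      if y - z ∈ cube (d + 1) N then ∑ κ : Fin (d + 1), (pm ρ N β y κ z : ℝ) * A x z a (Sum.inl κ) else 0 := by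
    intro z
    rw [← sum_piK_col_inl ρ N z y β (fun f => A x z a f)]
    exact Finset.sum_congr rfl fun f _ => mul_comm _ _
  simp_rw [h]
  exact tsum_window' N y fun z => ∑ κ : Fin (d + 1), (pm ρ N β y κ z : ℝ) * A x z a (Sum.inl κ)

/-- [folklore] Entrywise limits pass through the LEFT factor `piKᵀ ∘ ·` (finite sums and products of convergent real sequences; NO letter on `K`). -/
theorem tendsto_comp_trK_piK {K : ℕ → MKer (d + 1) (Fib d)} {L : MKer (d + 1) (Fib d)}
    (hK : ∀ x y a b, Tendsto (fun j => K j x y a b) atTop (𝓝 (L x y a b))) (x y : Fin (d + 1) → ℤ) (a b : Fib d) :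
    Tendsto (fun j => comp (trK (piK ρ N)) (K j) x y a b) atTop (𝓝 (comp (trK (piK ρ N)) L x y a b)) := by
  rcases a with α | m
  · simp only [comp_trK_piK_inl]
    exact tendsto_finsetSum _ fun v _ => tendsto_finsetSum _ fun κ _ => (hK _ _ _ _).const_mul _
  · simp only [trK_piK_comp_inr]
    exact hK _ _ _ _

/-- [folklore] **ENTRYWISE LIMITS PASS THROUGH THE AXIAL CO-DRESSING** (any `d`, root `ρ`, blocking `N`; NO decay or summability letter on the family):
if `K j → L` entrywise then `coDressKAt ρ N (K j) → coDressKAt ρ N L` entrywise — the twin of road FP's `KPerfSymHolds.tendsto_coDressKSymAt`. -/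
theorem tendsto_coDressKAt {K : ℕ → MKer (d + 1) (Fib d)} {L : MKer (d + 1) (Fib d)}
    (hK : ∀ x y a b, Tendsto (fun j => K j x y a b) atTop (𝓝 (L x y a b))) (x y : Fin (d + 1) → ℤ) (a b : Fib d) :
    Tendsto (fun j => coDressKAt ρ N (K j) x y a b) atTop (𝓝 (coDressKAt ρ N L x y a b)) := by
  have h1 := tendsto_comp_trK_piK ρ N hK
  simp only [coDressKAt_eq]
  rcases b with β | μ
  · simp only [comp_piK_inl]
    exact tendsto_finsetSum _ fun v _ => tendsto_finsetSum _ fun κ _ => (h1 _ _ _ _).const_mul _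
  · simp only [comp_piK_inr]
    exact h1 _ _ _ _

/-- [folklore] **THE AXIAL CO-DRESSING COMMUTES WITH THE CONSTRUCTED LIMIT**: if `K j → L` entrywise then `limMKerOf (j ↦ coDressKAt ρ N (K j)) = coDressKAt ρ N L`
(`HessKerDressedLimit.limMKerOf_eq_of_tendsto`). -/
theorem limMKerOf_coDressKAt {K : ℕ → MKer (d + 1) (Fib d)} {L : MKer (d + 1) (Fib d)}
    (hK : ∀ x y a b, Tendsto (fun j => K j x y a b) atTop (𝓝 (L x y a b))) :
    limMKerOf (fun j => coDressKAt ρ N (K j)) = coDressKAt ρ N L :=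
  limMKerOf_eq_of_tendsto (tendsto_coDressKAt ρ N hK)

end Window

/-! ## §4 Dimension four: the perfect limit of the comb-chart resolvents, IDENTIFIED (no hypothesis) -/

/-- [our object] **THE UNIT-RESCALED COMB-CHART RESOLVENTS CONVERGE ENTRYWISE TO THE TWO CO-DRESSINGS OF THE PERFECT ONE-STEP RESOLVENT** (`d = 3`,
`Lc ≥ 2`): `unitK (sfStep Lc j) (smStep 3 Lc j) (GcombSh Lc j) → coDressKAt ρ_c Lc (coDressKSymAt ρ_c Lc (KPerf Lc (sfStep Lc) (smStep 3 Lc) 1))`, `ρ_c = ctr 4 Lc` —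
road FP's `KPerfSymHolds.tendsto_unitK_Gsym` pushed through §3 (units inside by asym1's `HessKerCoDressedWall.unitK_coDressKAt`). -/
theorem tendsto_unitK_GcombSh_perf (hLc : 2 ≤ Lc) (x y : Fin (3 + 1) → ℤ) (a b : Fib 3) :
    Tendsto (fun j => unitK (sfStep Lc j) (smStep 3 Lc j) (GcombSh (d := 3) Lc j) x y a b) atTop
      (𝓝 (coDressKAt (ctr (3 + 1) Lc) Lc (coDressKSymAt (ctr (3 + 1) Lc) Lc (KPerf (d := 3) Lc (sfStep Lc) (smStep 3 Lc) 1)) x y a b)) := by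
  have h := tendsto_coDressKAt (ctr (3 + 1) Lc) Lc (K := fun j => unitK (sfStep Lc j) (smStep 3 Lc j) (Gsym (d := 3) Lc j))
    (tendsto_unitK_Gsym hLc) x y a b
  refine h.congr' (Eventually.of_forall fun j => ?_)
  show coDressKAt (ctr (3 + 1) Lc) Lc (unitK (sfStep Lc j) (smStep 3 Lc j) (Gsym (d := 3) Lc j)) x y a b =
    unitK (sfStep Lc j) (smStep 3 Lc j) (GcombSh (d := 3) Lc j) x y a b
  rw [GcombSh_apply, unitK_coDressKAt _ _ (sfStep_ne_zero j) (smStep_ne_zero j)]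

/-- [our object] **THE PERFECT LIMIT OF THE COMB-CHART RESOLVENTS, IDENTIFIED** (`d = 3`, `Lc ≥ 2`; no hypothesis):
`limMKerOf (j ↦ unitK_j (GcombSh Lc j)) = coDressKAt ρ_c Lc (coDressKSymAt ρ_c Lc (KPerf Lc (sfStep Lc) (smStep 3 Lc) 1))`. -/
theorem limMKerOf_unitK_GcombSh (hLc : 2 ≤ Lc) :
    limMKerOf (fun j => unitK (sfStep Lc j) (smStep 3 Lc j) (GcombSh (d := 3) Lc j)) =
      coDressKAt (ctr (3 + 1) Lc) Lc (coDressKSymAt (ctr (3 + 1) Lc) Lc (KPerf (d := 3) Lc (sfStep Lc) (smStep 3 Lc) 1)) :=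
  limMKerOf_eq_of_tendsto (tendsto_unitK_GcombSh_perf hLc)

/-- [our object] **GEOMETRIC `Decays`-RATE OF THE UNIT COMB-CHART RESOLVENTS TO THEIR IDENTIFIED PERFECT LIMIT** (`d = 3`, `Lc ≥ 2`; constant and rate from §1,
SAME constant): `∀ k, Decays (unitK_k (GcombSh Lc k) − coDressKAt ρ_c Lc (coDressKSymAt ρ_c Lc (KPerf … 1))) (cK·θ^k) δ`. -/
theorem decays_unitK_GcombSh_sub_perf (hLc : 2 ≤ Lc) :
    ∃ δ cK θ : ℝ, 0 < δ ∧ 0 ≤ θ ∧ θ < 1 ∧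
      ∀ k, Decays (unitK (sfStep Lc k) (smStep 3 Lc k) (GcombSh (d := 3) Lc k) -
        coDressKAt (ctr (3 + 1) Lc) Lc (coDressKSymAt (ctr (3 + 1) Lc) Lc (KPerf (d := 3) Lc (sfStep Lc) (smStep 3 Lc) 1))) (cK * θ ^ k) δ := by
  obtain ⟨δ, cK, θ, hδ, hθ0, hθ1, h⟩ := decays_unitK_GcombSh_sub_lim hLc
  refine ⟨δ, cK, θ, hδ, hθ0, hθ1, fun k => ?_⟩
  rw [← limMKerOf_unitK_GcombSh hLc]
  exact h k

/-- [our object] **THE PERFECT COMB-CHART RESOLVENT DECAYS** (`d = 3`, `Lc ≥ 2`): road FP's `KPerfSymHolds.exists_decays_coDressKSymAt_KPerf_one` at the centred root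
pushed through the axial pass by asym1's `HessKerCoDressedWall.exists_decays_coDressKAt`. -/
theorem decays_GcombPerf (hLc : 2 ≤ Lc) :
    ∃ δ C : ℝ, 0 < δ ∧ 0 ≤ C ∧
      Decays (coDressKAt (ctr (3 + 1) Lc) Lc (coDressKSymAt (ctr (3 + 1) Lc) Lc (KPerf (d := 3) Lc (sfStep Lc) (smStep 3 Lc) 1))) C δ := by
  obtain ⟨δ, C, hδ, hC, hK⟩ := exists_decays_coDressKSymAt_KPerf_one hLc (ctrOff_mem_box (one_le_of_neZero Lc))
  obtain ⟨c, hc0, hc⟩ := exists_decays_coDressKAt (d := 3) (one_le_of_neZero Lc) (ctrOff_mem_box (one_le_of_neZero Lc)) hδ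
  exact ⟨δ / 4, c * C, by linarith, mul_nonneg hc0 hC, hc _ _ hK⟩

end Summit.QuantumFields.BalabanUV.Beta.GAN24.KSlotCombChart

end
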